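import Summits.BirchSwinnertonDyer.Rank1Residual.Additive.X4TamDefectLevelLoweringFromPrintTwistPos
import Literature.NumberTheory.EllipticCurves.ModularJacobianModPMultiplicityOne
import HarnessLib

/-!
# TAM-DEFECT₂ on the twist-good locus from the PRINTED multiplicity-one theorem (DDT Thm. 4.26, typed `wiles1995_multiplicityOne`) + ONE Eichler–Shimura dictionary node (cell `b2b-bsdres`, seat additive-p4, line V42/V43 re-key)

HONEST FRAMING (verbatim, cell `b2b-bsdres`): the goal of the cell is to DELETE the COMBINATION-SHAPED
residual classes for ALL analytic-rank `≤ 1` curves over `ℚ` — "full BSD formula for every rank `≤ 1`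
curve in class `C`" assembled STRICTLY from published theorems — so that the rank-`≤ 1` remainder
becomes exactly the CONSTRUCTION-SHAPED classes, which are TYPED (missing-input Props), NOT attempted;
this is not "finishing BSD". This file: ONE typed target (`@[conjecture] def`, asserting nothing) — the
mod-`p` Eichler–Shimura DICTIONARY from the printed `J₀(N)[𝔪]`-statement to the seat's predicate
`ModPMultiplicityOne` — and the RE-KEYED END of gen 23's `X4.bsdp_of_multiplicityOne_quadraticTwist_of_pos_of_five_le`
whose (MO) binder is now DISCHARGED from the landed named fact
`Literature.NumberTheory.EllipticCurves.ModularForms.wiles1995_multiplicityOne` (cc-typer-1, p317688: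
Darmon–Diamond–Taylor Thm. 4.26 = Ribet 1990 Thm. 5.2 (b) / Mazur–Ribet / Wiles 1995 Thm. 2.1, AS
PRINTED over `J0 N = S₂(Γ₀(N))^∨ ⧸ H₁(X₀(N), ℤ)`) + the dictionary node + the Galois package of the fact's
hypotheses. Duty of record: cc-lead GEN 41 ADDENDUM 2 (A2) / GEN 45 ("additive-p4 writes the re-keyed
END + ES-dictionary node next to K2"). Nothing booked; X4 CONSTRUCTION-SHAPED; no Literature fact minted.

## The dictionary node (what it says; why a TARGET and not a fact)

`LevelLowering.EichlerShimuraModPMultiplicityOne N p χ θ`: for a ring map `χ : 𝕋_ℤ → k`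
(`𝕋_ℤ = HeckeRing0 N 2`, DDT §4.1) with `χ(T_q) = θ(q)` at every prime `q`, `p ∈ 𝔪 := ker χ`, `𝔪`
maximal: IF `dim_{𝕋/𝔪} J₀(N)[𝔪] = 2` (the printed conclusion) THEN the `θ`-eigen plus subspace of
`Symb_{Γ₀(N)}(Sym⁰ k)` has dimension `≤ 1` (`ModPMultiplicityOne k N θ`). CONTENT (standard, not typed in
the tree): `J₀(N)[p] ≅ H₁(X₀(N), ℤ) ⊗ 𝔽_p` Hecke-equivariantly (from `J0 N = S₂^∨ ⧸ H₁`), duality with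
`H¹(X₀(N), 𝔽_p)`, the boundary sequence `Symb_{Γ₀(N)}(k) = H¹_c(Y₀(N), k) → H¹(X₀(N), k)` whose kernel
(boundary symbols) is EISENSTEIN and so vanishes after localisation at the non-Eisenstein `𝔪`, and the
splitting into `±` parts under `ι = diag(−1,1)` (`p` odd), each of `𝕋/𝔪`-dimension `1` when the total is
`2`; base change along `𝕋/𝔪 → k`. RIDER `ES-dict-p3-elliptic` (print seat n1011-lit, 2026-08-22): the
comparison `Symb_Γ(k) ≅ H¹_c(Y_Γ, k)` (Ash–Stevens 1986) wants the torsion orders of `Γ = Γ₀(N)/±1`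
invertible in `k`; `Γ₀(N)` has elliptic points of order `3` iff `9 ∤ N` and every prime `q ∣ N` is `3` or
`≡ 1 (mod 3)` — displayed as the hypothesis `p ≠ 3 ∨ 9 ∣ N ∨ ∃ q ∣ N prime, q ≡ 2 (mod 3)`. A TARGET;
nothing asserted.

## The re-keyed END

`X4.bsdp_of_wiles1995_quadraticTwist_of_pos_of_five_le`: gen 23's census-shape END on the
TWIST-GOOD locus (`E = C • W₀^{(d)}`, `d > 0`, `p ≥ 5`, r_an `= 0`, `ρ̄_{E,p}` onto, conductor-level datum
with `p ∤ c_D` and the period transfer, `#Ш_an` unit, `ord_p ∏c ≤ 2`, (OLD) at a Tamagawa prime `ℓ`)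
with the binder (MO) REPLACED by: the named fact `wiles1995_multiplicityOne` (BY NAME), the
eigencharacter `χ₀ : 𝕋_ℤ(N₀) → k` of `f_{W₀}` mod `p` (`χ₀(T_q) = a_q(W₀) mod p`), `𝔪₀ = ker χ₀` maximal
with `p ∈ 𝔪₀`, the printed level condition (`p ∤ N₀` ∨ `p ∥ N₀ ∧ T_p ∉ 𝔪₀`), the fact's Galois package
(some `ρ : ModPGaloisRep ℚ k' 2` unramified outside `N₀p` with `charpoly ρ(Frob_q) = X² − (T_q mod 𝔪₀)X + q`,
irreducible — per row: `E[p]` via `WeierstrassCurve.IsTorsionGaloisRep`, its Frobenius char-polys and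
irreducibility, NOT assembled here), and the dictionary node at `(N₀, p, χ₀, θ̄_{W₀})`. Everything else
(Kim (6), CT, GZK, modularity, the twist identities, Pal's period unit) as in gen 23.

## References

* H. Darmon, F. Diamond, R. Taylor, *Fermat's Last Theorem* (1995), Thm. 4.26 (§4.5 p. 134), §1.3, §4.1. [cite: DarmonDiamondTaylor1995, Thm. 4.26 (§4.5, p. 134)]
* A. Ash, G. Stevens, Duke Math. J. 53 (1986), §4 (modular symbols vs. compactly supported cohomology). [cite: AshStevens1986, §4]
* Ju. I. Manin, *Parabolic points and zeta functions of modular curves* (1972), Thm. 1.9; L. Merel, LNM 1585 (1994), §1.2–1.4. [cite: Manin1972, Thm. 1.9] [cite: Merel1994, §1.2]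
* K. Ribet, Invent. Math. 100 (1990), Thm. 5.2 (b); A. Wiles, Ann. of Math. 141 (1995), Thm. 2.1. [cite: Ribet1990, Thm. 5.2 (b)]
* C.-H. Kim, Amer. J. Math. 148 (2026) = arXiv:2203.12159, Thm. 1.9 (6), Conj. 1.10. [cite: Kim2022StructureSelmer, Thm. 1.9 (6) and Conj. 1.10 (PDF p. 8)]
-/

noncomputable section

open scoped MatrixGroups ModularForm NumberTheorySymbols NumberField

open CongruenceSubgroup Finset IsDedekindDomain Polynomial

open Literature.NumberTheory.EllipticCurves Literature.NumberTheory.EllipticCurves.ModularForms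

namespace Summit.BirchSwinnertonDyer.Rank1Residual.LevelLowering

/-! ### §1 The Eichler–Shimura mod-`p` dictionary node -/

section Dictionary

variable {k : Type*} [CommRing k] (N : ℕ) [NeZero N] (p : ℕ) (χ : HeckeRing0 N 2 →+* k) (θ : ℕ → k)

/-- **EICHLER–SHIMURA mod-`p` DICTIONARY (typed target).** For `χ : 𝕋_ℤ(N) → k` with
`χ(T_q) = θ(q)` at every prime `q`, `p ∈ ker χ` and `ker χ` maximal: the printed multiplicity-one
CONCLUSION `dim_{𝕋/ker χ} J₀(N)[ker χ] = 2` (`J0 N = S₂(Γ₀(N))^∨ ⧸ H₁(X₀(N),ℤ)`, DDT §1.3 / Thm. 4.26)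
implies (MO) `ModPMultiplicityOne k N θ` (the `θ`-eigen plus subspace of `Symb_{Γ₀(N)}(Sym⁰ k)` has
dimension `≤ 1`), granted the rider `ES-dict-p3-elliptic` (`p ≠ 3`, or `Γ₀(N)` has no elliptic point
of order `3`: `9 ∣ N` or some prime `q ∣ N` with `q ≡ 2 (mod 3)`). Standard (`J₀(N)[p] ≅ H₁ ⊗ 𝔽_p`,
duality, boundary symbols Eisenstein, `±`-splitting for odd `p`, Ash–Stevens for the comparison with
`H¹_c`) but NOT typed in the tree: A TARGET; nothing asserted. SUPERSEDED (print-police finding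
F1, n1011-lit 2026-08-22: the dictionary needs `ker χ` NON-Eisenstein, which this node does not bind —
its binders are satisfiable at an Eisenstein `𝔪`, Mazur 1977 Cor. II.16.3): use
`EichlerShimuraModPMultiplicityOneOfIrreducible` (file `X4TamDefectLevelLoweringFromWilesIrreducible`),
which adds the printed theorem's irreducibility package and is implied by this node.
[cite: DarmonDiamondTaylor1995, Thm. 4.26 (§4.5, p. 134)] [cite: AshStevens1986, §4]
[cite: Manin1972, Thm. 1.9] -/
@[conjecture] def EichlerShimuraModPMultiplicityOne : Prop :=
  (∀ (q : ℕ) (hq : q.Prime), χ (HeckeRing0.T N 2 q hq) = θ q) →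
    (p : HeckeRing0 N 2) ∈ RingHom.ker χ → (RingHom.ker χ).IsMaximal →
    Module.finrank (HeckeRing0 N 2 ⧸ RingHom.ker χ)
        (Submodule.torsionBySet (HeckeRing0 N 2) (J0 N) (RingHom.ker χ : Set (HeckeRing0 N 2))) = 2 →
    (p ≠ 3 ∨ 9 ∣ N ∨ ∃ q : ℕ, q.Prime ∧ q ∣ N ∧ q % 3 = 2) →
    ModPMultiplicityOne k N θ

variable {N p χ θ}

/-- If (MO) holds outright, the dictionary target holds (vacuity of the implication). [folklore] -/
theorem eichlerShimuraModPMultiplicityOne_of_modPMultiplicityOne (h : ModPMultiplicityOne k N θ) :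
    EichlerShimuraModPMultiplicityOne N p χ θ :=
  fun _ _ _ _ _ ↦ h

end Dictionary

end Summit.BirchSwinnertonDyer.Rank1Residual.LevelLowering

/-! ### §2 The re-keyed END: (MO) from `wiles1995_multiplicityOne` + the dictionary -/

namespace Summit.BirchSwinnertonDyer.Rank1Residual.X4

open Complex WeierstrassCurve Literature.NumberTheory.EllipticCurves.Rank1Residual
  Literature.NumberTheory.EllipticCurves.Rank1Residual.Typed
  Summit.BirchSwinnertonDyer.Rank1Residual.Additive
  Summit.BirchSwinnertonDyer.Rank1Residual.LevelLowering
  Literature.NumberTheory.GaloisRepresentations Rat.HeightOneSpectrum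

variable {k : Type*} [CommRing k] [Nontrivial k]
  (W₀ W : WeierstrassCurve ℚ) [W₀.IsElliptic] [W₀.IsGloballyMinimal] [W.IsElliptic] [W.IsGloballyMinimal]
  (p : ℕ) [hp5 : Fact p.Prime] (ι : ZMod p →+* k)

/-- **TAM-DEFECT₂ ON THE TWIST-GOOD LOCUS FROM THE PRINTED MULTIPLICITY-ONE THEOREM (census shape,
`d > 0`).** Gen 23's `bsdp_of_multiplicityOne_quadraticTwist_of_pos_of_five_le` with its (MO) binder
DISCHARGED from: the named fact `wiles1995_multiplicityOne` (DDT Thm. 4.26, BY NAME), the mod-`p`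
eigencharacter `χ₀ : 𝕋_ℤ(N₀) → k` of `W₀` (`χ₀(T_q) = ι(a_q(W₀) mod p)`), `𝔪₀ = ker χ₀` maximal with
`p ∈ 𝔪₀`, the printed level condition `p ∤ N₀ ∨ (p² ∤ N₀ ∧ T_p ∉ 𝔪₀)`, the fact's Galois package
(`ρ : ModPGaloisRep ℚ k' 2` unramified outside `N₀ p` with `charpoly ρ(Frob_q) = X² − (T_q mod 𝔪₀) X + q`,
irreducible), and the dictionary TARGET `EichlerShimuraModPMultiplicityOne N₀ p χ₀ θ̄_{W₀}` (rider moot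
at `p ≥ 5`). All other inputs as in gen 23: Kim 2026 Thm. 1.8 (6), Cassels–Tate, GZK, modularity
(PUBLISHED) + (OLD) at the Tamagawa prime `ℓ` + numerals ⟹ **`BSD(E,p)`**. Nothing booked.
[cite: DarmonDiamondTaylor1995, Thm. 4.26 (§4.5, p. 134)] [cite: Kim2022StructureSelmer, Thm. 1.9 (6) and Conj. 1.10 (PDF p. 8)]
[cite: Ribet1990, Thm. 1.1 and Thm. 5.2 (b)] [cite: SilvermanAEC2009, Thm. X.4.14] -/
theorem bsdp_of_wiles1995_quadraticTwist_of_pos_of_five_le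
    (hW1 : wiles1995_multiplicityOne)
    (hKimk : Kim2026.rankZero_le_padicValNat_sha_of_kuriharaNumber_ne_zero)
    (hE67c : Kim2026.rankZero_padicValNat_sha_add_le_of_forall_pow_dvd_kuriharaNumber_cyclicLevel)
    (hCT : exists_casselsTate_pairing (K := ℚ))
    (hGZK : rank_eq_analyticRank_of_analyticRank_le_one) (hmod : hasEntireLFunction_rat)
    (hp : 5 ≤ p) (hr : W.analyticRank = 0) (hsurj : W.HasSurjectiveModNGaloisRep p)
    {N : ℕ} [NeZero N] (D : ModularParametrizationData W N) (hN : W.conductorNorm ℤ = N)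
    (hc : ¬ (p : ℤ) ∣ D.maninConstant)
    (hper : ∃ u : ℚ, ‖(u : ℚ_[p])‖ = 1 ∧ W.realPeriodRat = u * plusPeriod D.f)
    {q' : ℚ} (hq' : shaAn W = (q' : ℂ)) (hv : padicValRat p q' = 0)
    (hc2 : padicValNat p W.tamagawaProduct ≤ 2)
    -- the geometric twist datum
    {d : ℤ} (hd4 : d % 4 = 1) (hsq : Squarefree d) (hd : 0 < d) (C : VariableChange ℚ)
    (hC : C • W₀.quadraticTwist (d : ℚ) = W)
    (hgm : ∀ v : HeightOneSpectrum (𝓞 ℚ), ((Rat.HeightOneSpectrum.primesEquiv v : ℕ) : ℤ) ∣ d →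
      W₀.HasGoodReductionAt v ∨ W₀.HasMultiplicativeReductionAt v)
    {N₀ : ℕ} [NeZero N₀] [NeZero d.natAbs] {f₀ : CuspForm (Gamma0 N₀) 2} (hf₀ : IsNewformOf W₀ f₀)
    (hN₀ : N₀ ∣ N) (hm : d.natAbs ^ 2 ∣ N) (hmN : d.natAbs ∣ W.conductorNorm ℤ)
    (hper₀ : ∃ u : ℚ, ‖(u : ℚ_[p])‖ = 1 ∧ W₀.realPeriodRat = u * plusPeriod f₀)
    (hirr₀ : W₀.HasIrreducibleModPGaloisRep p)
    -- (MO) from print: the eigencharacter, the printed hypotheses of DDT Thm. 4.26, the dictionary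
    (χ₀ : HeckeRing0 N₀ 2 →+* k)
    (hχ₀ : ∀ (q : ℕ) (hq : q.Prime), χ₀ (HeckeRing0.T N₀ 2 q hq) = ι ((W₀.LFunction q : ℤ) : ZMod p))
    (hp𝔪 : (p : HeckeRing0 N₀ 2) ∈ RingHom.ker χ₀) (h𝔪 : (RingHom.ker χ₀).IsMaximal)
    (hpN₀ : ¬ p ∣ N₀ ∨ (¬ p ^ 2 ∣ N₀ ∧ HeckeRing0.T N₀ 2 p hp5.out ∉ RingHom.ker χ₀))
    (k' : Type) [Field k'] [TopologicalSpace k'] [DiscreteTopology k']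
    (ι' : HeckeRing0 N₀ 2 ⧸ RingHom.ker χ₀ →+* k') (ρ : ModPGaloisRep ℚ k' 2)
    (hρ : ∀ v : HeightOneSpectrum (𝓞 ℚ), ¬ ((primesEquiv v : Nat.Primes) : ℕ) ∣ N₀ * p →
        ρ.IsUnramifiedAt v ∧
          ρ.HasFrobCharpolyAt v
            (X ^ 2
              - Polynomial.C (ι' (Ideal.Quotient.mk (RingHom.ker χ₀) (HeckeRing0.T N₀ 2
                  ((primesEquiv v : Nat.Primes) : ℕ) (primesEquiv v : Nat.Primes).2))) * X
              + Polynomial.C (((primesEquiv v : Nat.Primes) : ℕ) : k')))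
    (hρirr : FramedRep.IsIrreducible ρ)
    (hES : EichlerShimuraModPMultiplicityOne N₀ p χ₀ (fun q ↦ ι ((W₀.LFunction q : ℤ) : ZMod p)))
    -- (OLD) at the Tamagawa prime
    {ℓ : ℕ} {w : k} {μ : ℚ → k} (hℓN : ℓ ∣ W.conductorNorm ℤ) (hℓ : ℓ.Coprime d.natAbs)
    (hOLD : HasOldEigenPlusSymb k N₀ (fun q ↦ ι ((W₀.LFunction q : ℤ) : ZMod p)) ℓ w μ)
    (hμ : IsPeriodic μ)
    (hH : ∀ q : ℕ, Kato.IsKolyvaginPrime W p 1 q → HeckeRel μ q (ι ((W₀.LFunction q : ℤ) : ZMod p)))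
    (hw : w * ι ((J((ℓ : ℤ) | d.natAbs) : ℤ) : ZMod p) = 1) : BSDp W p := by
  -- DDT Thm. 4.26 at `𝔪₀ = ker χ₀`: `dim_{𝕋/𝔪₀} J₀(N₀)[𝔪₀] = 2`
  have hp2 : p ≠ 2 := by omega
  have hfin := (hW1 N₀ p hp2 (RingHom.ker χ₀) h𝔪 hp𝔪 k' ι' ρ hρ hρirr hpN₀).1
  -- the dictionary: (MO) for the `θ̄_{W₀}`-eigen plus symbols of level `N₀` (rider moot at `p ≥ 5`)
  have hMO : ModPMultiplicityOne k N₀ (fun q ↦ ι ((W₀.LFunction q : ℤ) : ZMod p)) :=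
    hES hχ₀ hp𝔪 h𝔪 hfin (Or.inl (by omega))
  exact bsdp_of_multiplicityOne_quadraticTwist_of_pos_of_five_le W₀ W p ι hKimk hE67c hCT hGZK hmod hp
    hr hsurj D hN hc hper hq' hv hc2 hd4 hsq hd C hC hgm hf₀ hN₀ hm hmN hper₀ hirr₀ hMO hℓN hℓ hOLD hμ
    hH hw

end Summit.BirchSwinnertonDyer.Rank1Residual.X4

end
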